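import Summits.CriticalPhenomena.PercolationContinuityZ3.Theorems.Transplant.FKConnectivityAllQForestTreeLevel
import Summits.CriticalPhenomena.PercolationContinuityZ3.Theorems.Transplant.FKConnectivityAllQForestTightInsideDecoupling
import Summits.CriticalPhenomena.PercolationContinuityZ3.Theorems.Transplant.FKConnectivityAllQForestStarDescent
import HarnessLib

/-!
# (♣)⁰ INSIDE A TIGHT SET, unconditionally: the tree level + the inside decoupling

Support file (`--supports stmt-CriticalPhenomena-4575`), FK sub-lane `prim-bschramm-fk-1` (generation 29) of the post-continuity
programme; builds on p205010 (kernel theorem, internal audit signed; external expert review pending).  No definitions, no named facts,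
no sorries; standard axioms.

Combining `adjForestNoSq_fibre_of_tight` (the node on every tight fibre = Cibulka–Hladký–LaCroix–Wagner at an adjacent pair) with
`adjForestNoSq_fibre_of_tightInside` (a tight vertex set containing `o, v, y` decouples):
* **`adjForestNoSq_fibre_of_tightSetInside`** — on ANY fibre `(M, u)` (`Disjoint u M`, `v ≠ y`), if `o, v, y` lie in a finite vertex set `U`
  whose inside pairs satisfy `2|U| ≤ |M ∩ E₁(U)| + 2|u ∩ E₁(U)| + 2`, then `#(Fo ∩ {e, f ∈ ω}, Fo) ≤ #(Fo ∩ {e ∈ ω}, Fo ∩ {f ∈ ω})`;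
* **`adjForestNoSq_top_of_tightSet`** — simple-graph form on the top fibre `(Eg, ∅)`: (♣)⁰ holds at `(o; ov, oy)` in every finite simple
  graph in which `o, v, y` lie in a vertex set `U` spanning at least `2|U| − 2` edges (a `K₄`, a wheel, `K_{3,3}` plus an edge, any
  generic rigidity circuit, any edge-disjoint union of two spanning trees of `U`) — whatever the rest of the graph;
* **`adjForestNoSq_top_of_tight`** — in particular on every `(2,2)`-tight simple graph (`2|V| ≤ |Eg| + 2`) at every adjacent pair.
These classes are new and unconditional (beyond the triangle / locally-connected / ears / cone theorems of g21–g22: e.g. `K_{3,3} + o'o''` with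
`o` on one side and `v, y` on the other has `v, y` unlinked in `N(o)` and `vy ∉ E`).
* **`adjForestNoSq_fibre_of_laman_of_redJoin`** — ONE LEVEL BELOW TIGHT (`2|S| ≤ |N| + 2|u₀| + 3`: Laman level or denser), a SINGLE red-join
  inequality (RJ) of g27 (`…ForestStarDescent`) at ONE non-neighbour `s ∈ S` of `o` gives the node, because `(N ∪ {os}, u₀)` is tight: the star
  descent `adjForestNoSq_fibre_of_insert_star` needs only one stage instead of the whole descent from the cone.
[cite: CibulkaHladkyLaCroixWagner2008, Thm. 1 (p. 2)] [cite: SempleWelsh2008, Conj. 1.1 (p. 2); Thm. 4.2 (p. 11)] [cite: Linusson2011, Prop. 2.6]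
-/

noncomputable section

namespace Summit.CriticalPhenomena.PercolationContinuityZ3.Theorems
namespace FK

open MeasureTheory Set Literature.Probability.LatticeModels Literature.Probability.Percolation
open scoped Classical symmDiff

variable {V : Type*} [Fintype V]

/-- **(♣)⁰ inside a tight set, every fibre.**  If `o, v, y ∈ U` and the pairs of the fibre inside `U` number at least `2|U| − 2`
(pinned pairs twice), the node's inequality holds on `(M, u)`. [cite: CibulkaHladkyLaCroixWagner2008, Thm. 1 (p. 2)]
[cite: SempleWelsh2008, Conj. 1.1 (p. 2)] [cite: Linusson2011, Prop. 2.6] -/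
theorem adjForestNoSq_fibre_of_tightSetInside {M u : BondConfig V} {U : Finset V} {o v y : V} (hd : Disjoint u M) (hvy : v ≠ y)
    (ht : 2 * U.card ≤ (M ∩ {g : Sym2 V | ∀ w ∈ g, w ∈ U}).ncard + 2 * (u ∩ {g : Sym2 V | ∀ w ∈ g, w ∈ U}).ncard + 2)
    (ho : o ∈ U) (hv : v ∈ U) (hy : y ∈ U) :
    fibreCount M u (forestEv V ∩ {ω | s(o, v) ∈ ω ∧ s(o, y) ∈ ω}) (forestEv V) ≤
      fibreCount M u (forestEv V ∩ {ω | s(o, v) ∈ ω}) (forestEv V ∩ {ω | s(o, y) ∈ ω}) :=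
  adjForestNoSq_fibre_of_tightInside ht ho hv hy
    (adjForestNoSq_fibre_of_tight U ((hd.mono_left inter_subset_left).mono_right inter_subset_left) hvy
      (fun _ hg w hw => hg.elim (fun h => h.2 w hw) (fun h => h.2 w hw)) ht)

/-- **(♣)⁰ inside a tight set, simple graphs.**  In a finite simple graph `Eg`, if `o, v, y` (`v ≠ y`) lie in a vertex set `U` spanning
at least `2|U| − 2` edges, then on the top fibre `#(Fo ∩ {ov, oy ∈ ω}, Fo) ≤ #(Fo ∩ {ov ∈ ω}, Fo ∩ {oy ∈ ω})`: the pairs `ov, oy` are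
negatively correlated in the uniform ordered two-forest partition of `Eg`, whatever the rest of the graph.
[cite: CibulkaHladkyLaCroixWagner2008, Thm. 1 (p. 2)] [cite: SempleWelsh2008, Conj. 1.1 (p. 2); Thm. 4.2 (p. 11)] -/
theorem adjForestNoSq_top_of_tightSet {Eg : Set (Sym2 V)} {U : Finset V} {o v y : V} (hvy : v ≠ y)
    (ht : 2 * U.card ≤ (Eg ∩ {g : Sym2 V | ∀ w ∈ g, w ∈ U}).ncard + 2) (ho : o ∈ U) (hv : v ∈ U) (hy : y ∈ U) :
    fibreCount Eg ∅ (forestEv V ∩ {ω | s(o, v) ∈ ω ∧ s(o, y) ∈ ω}) (forestEv V) ≤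
      fibreCount Eg ∅ (forestEv V ∩ {ω | s(o, v) ∈ ω}) (forestEv V ∩ {ω | s(o, y) ∈ ω}) :=
  adjForestNoSq_fibre_of_tightSetInside (Set.empty_disjoint _) hvy (by rw [empty_inter, ncard_empty]; omega) ho hv hy

/-- **(♣)⁰ on every `(2,2)`-tight simple graph** (`2|V| ≤ |Eg| + 2`: an edge-disjoint union of two spanning trees, e.g. `K₄`, the
wheels), at every adjacent pair `ov, oy` (`v ≠ y`). [cite: CibulkaHladkyLaCroixWagner2008, Thm. 1 (p. 2)] [cite: SempleWelsh2008, Conj. 1.1 (p. 2)] -/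
theorem adjForestNoSq_top_of_tight {Eg : Set (Sym2 V)} {o v y : V} (hvy : v ≠ y) (ht : 2 * Fintype.card V ≤ Eg.ncard + 2) :
    fibreCount Eg ∅ (forestEv V ∩ {ω | s(o, v) ∈ ω ∧ s(o, y) ∈ ω}) (forestEv V) ≤
      fibreCount Eg ∅ (forestEv V ∩ {ω | s(o, v) ∈ ω}) (forestEv V ∩ {ω | s(o, y) ∈ ω}) :=
  adjForestNoSq_fibre_of_tight_univ (Set.empty_disjoint _) hvy (by rw [ncard_empty]; omega)

/-- **Laman level: one red-join inequality suffices.**  If the fibre `(N, u₀)` lies inside `S` with `2|S| ≤ |N| + 2|u₀| + 3` and `s ∈ S`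
is not joined to `o ∈ S` by a pair of the fibre, then the red-join inequality (RJ) at `s` implies the node's inequality on `(N, u₀)` — the
star pair `os` makes the fibre tight, where the tree level holds. [cite: CibulkaHladkyLaCroixWagner2008, Thm. 1 (p. 2)]
[cite: SempleWelsh2008, Conj. 1.1 (p. 2)] [cite: Linusson2011, Prop. 2.6] -/
theorem adjForestNoSq_fibre_of_laman_of_redJoin {N u₀ : BondConfig V} {o v y s : V} (S : Finset V) (hd : Disjoint u₀ N) (hvy : v ≠ y)
    (hS : ∀ g ∈ N ∪ u₀, ∀ w ∈ g, w ∈ S) (hl : 2 * S.card ≤ N.ncard + 2 * u₀.ncard + 3) (hoS : o ∈ S) (hsS : s ∈ S)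
    (hos : o ≠ s) (hsv : s ≠ v) (hsy : s ≠ y) (hN : s(o, s) ∉ N) (hu : s(o, s) ∉ u₀)
    (hRJ : fibreCount N u₀ (forestEv V ∩ {ω | s(o, v) ∈ ω ∧ s(o, y) ∈ ω} ∩ reachEv o s) (forestEv V) +
        fibreCount N u₀ (forestEv V ∩ reachEv o s) (forestEv V ∩ {ω | s(o, v) ∈ ω ∧ s(o, y) ∈ ω}) ≤
      fibreCount N u₀ (forestEv V ∩ {ω | s(o, v) ∈ ω} ∩ reachEv o s) (forestEv V ∩ {ω | s(o, y) ∈ ω}) +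
        fibreCount N u₀ (forestEv V ∩ {ω | s(o, y) ∈ ω} ∩ reachEv o s) (forestEv V ∩ {ω | s(o, v) ∈ ω})) :
    fibreCount N u₀ (forestEv V ∩ {ω | s(o, v) ∈ ω ∧ s(o, y) ∈ ω}) (forestEv V) ≤
      fibreCount N u₀ (forestEv V ∩ {ω | s(o, v) ∈ ω}) (forestEv V ∩ {ω | s(o, y) ∈ ω}) := by
  refine adjForestNoSq_fibre_of_insert_star hos hsv hsy hN hu hRJ (adjForestNoSq_fibre_of_tight S ?_ hvy ?_ ?_)
  · exact Set.disjoint_insert_right.2 ⟨hu, hd⟩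
  · intro g hg w hw
    rcases hg with hg | hg
    · rcases mem_insert_iff.1 hg with rfl | hg
      · rcases Sym2.mem_iff.1 hw with rfl | rfl
        · exact hoS
        · exact hsS
      · exact hS g (Or.inl hg) w hw
    · exact hS g (Or.inr hg) w hw
  · rw [ncard_insert_of_notMem hN (toFinite _)]
    omega

end FK
end Summit.CriticalPhenomena.PercolationContinuityZ3.Theorems

end
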